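import Mathlib.Analysis.Normed.Algebra.MatrixExponential
import Mathlib.Analysis.SpecialFunctions.Exponential
import Mathlib.Analysis.SpecialFunctions.Trigonometric.Deriv
import Mathlib.Analysis.SpecialFunctions.Complex.Arg
import Mathlib.Analysis.Calculus.MeanValue
import Literature.NumberTheory.Automorphic.GL2WeightOneCasimir
import Literature.NumberTheory.Automorphic.InvariantOperatorEigenfunctions
import HarnessLib

/-!
# `exp (θ W) = cos θ + sin θ W`: the one-parameter group of `W = (0 1; -1 0)` is `SO(2)`

Topic `NumberTheory/Automorphic` (archimedean structure of `GL₂(ℝ)`; companion to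
`GL2WeightOneCasimir`, whose `GL2Real.W = (0 1; -1 0)` is the infinitesimal generator of the
maximal compact subgroup `SO(2) ⊆ GL₂(ℝ)⁺`, `H = -iW` the weight operator).  To read
`SO(2)`-types (Bump, *Automorphic Forms and Representations* (1997), §2.2, (2.18)–(2.19):
`κ_θ = exp(θ W) = (cos θ, sin θ; -sin θ, cos θ)`) off `𝔨`-weights through the tree's
`RealMatrixGroup.expK` (matrix exponential), one needs the closed form of the exponential of
`W` and the description of `O(2)`.  This file proves:

* `GL2Real.kappa θ = cos θ · 1 + sin θ · W = (cos θ, sin θ; -sin θ, cos θ)` (`kappa_eq`), the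
  addition formula `kappa_mul_kappa`, `kappa_zero`, `kappa_mul_kappa_neg`, `hasDerivAt_kappa`
  (`kappa' = kappa · W`, in the Banach algebra `Matrix (Fin 2) (Fin 2) ℝ` with the `L^∞` operator
  norm, `open scoped Matrix.Norms.Operator` as in Mathlib's `Matrix.exp_add_of_commute`);
* `GL2Real.exp_smul_W : NormedSpace.exp (θ • W) = kappa θ` — by the standard uniqueness argument
  (`F(θ) = exp(θW) kappa(-θ)` has derivative `0`, Mathlib `hasDerivAt_exp_smul_const` and
  `is_const_of_deriv_eq_zero`); `exp_smul_W_eq` (coordinates), `exp_two_pi_smul_W`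
  (**`exp (2π W) = 1`**), `exp_pi_smul_W` (**`exp (π W) = -1`**);
* `GL2Real.exists_kappa_of_orthogonal` — **`O(2) = SO(2) ⊔ SO(2)·diag(1,-1)`**: a real `2 × 2`
  matrix `g` with `gᵀ g = 1` is `kappa θ` or `kappa θ · X₁` for some `θ` (elementary: the first
  column is a unit vector `(cos θ, -sin θ)`, `θ = arg(a - ic)`, and the second column is
  `±(sin θ, cos θ)`); `kappa_mul_X₁` (coordinates of the reflected rotations).

Everything is proved; the only definition is `kappa`; no named fact.  Downstream use: the
periodicity `expK (2π W) = 1` quantises the `𝔨`-weights of `W / W'` to integers and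
`expK (π W) = -1` reads the central sign of `AutomorphicRepData.IsOfWeightOne`
(`StrongArtinGL2WeightOneDictionary`) as oddness of the weights (`GKModulesOneParameter`).

## Mathlib / Literature search

Mathlib has `Matrix.exp` (= `NormedSpace.exp`), `Matrix.exp_diagonal`, `exp_units_conj`,
`hasDerivAt_exp_smul_const`, `Real.cos/sin` derivatives, `Complex.cos_arg`, `Complex.sin_arg`,
`Matrix.orthogonalGroup`, but no closed form for the exponential of a rotation generator and no
parametrisation of `O(2)` / `SO(2)` by angles (`lean search 'exp.*rotation|rotation.*exp|
specialOrthogonalGroup.*cos'`: no hits in Mathlib or the tree). Nothing here duplicates an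
existing declaration.

## References

* D. Bump, *Automorphic Forms and Representations* (1997), §2.2, (2.18)–(2.19). [Bump1997]
* A. W. Knapp, *Lie Groups Beyond an Introduction* (2002), 0.§2, Prop. 0.11 (one-parameter
  groups `t ↦ exp tX`). [Knapp2002]
-/

open scoped Matrix MatrixGroups

noncomputable section

namespace Literature.NumberTheory.Automorphic

namespace GL2Real

open NormedSpace

/-- Bump's rotation **`κ_θ = cos θ · 1 + sin θ · W = (cos θ, sin θ; -sin θ, cos θ)`** (Bump 1997, (2.18):
`κ_θ`), as a matrix polynomial in `W`; it is `exp (θ W)` (`exp_smul_W`).  Orientation: `κ_θ` is the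
rotation `rot (-θ)` of `InvariantOperatorEigenfunctions` (Iwaniec's `k(θ) = (cos θ, -sin θ; sin θ, cos θ)
∈ SL₂(ℝ)`), see `kappa_eq_coe_rot_neg`. [cite: Bump1997, (2.18)] -/
def kappa (θ : ℝ) : Matrix (Fin 2) (Fin 2) ℝ := Real.cos θ • (1 : Matrix (Fin 2) (Fin 2) ℝ) + Real.sin θ • W

/-- Entries of `kappa θ`. [folklore] -/
theorem kappa_eq (θ : ℝ) : kappa θ = !![Real.cos θ, Real.sin θ; -Real.sin θ, Real.cos θ] := by
  ext i j
  fin_cases i <;> fin_cases j <;> simp [kappa, W]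


/-- **Bridge of orientations**: `κ_θ = k(-θ)` for the rotation
`k(θ) = (cos θ, -sin θ; sin θ, cos θ) ∈ SL₂(ℝ)` of `InvariantOperatorEigenfunctions`
(`Literature.NumberTheory.Automorphic.rot`, Iwaniec's stability group of `i`), coerced to a
matrix.  So the topic carries ONE family of rotations in two typed forms. [folklore] -/
theorem kappa_eq_coe_rot_neg (θ : ℝ) :
    kappa θ = ((Literature.NumberTheory.Automorphic.rot (-θ) : SL(2, ℝ)) : Matrix (Fin 2) (Fin 2) ℝ) := by
  rw [kappa_eq, Literature.NumberTheory.Automorphic.rot]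
  ext i j
  fin_cases i <;> fin_cases j <;> simp [Real.cos_neg, Real.sin_neg]

/-- `kappa 0 = 1`. [folklore] -/
@[simp]
theorem kappa_zero : kappa 0 = 1 := by simp [kappa]

/-- `kappa θ` commutes with `W` (it is a polynomial in `W`). [folklore] -/
theorem kappa_mul_W (θ : ℝ) : kappa θ * W = W * kappa θ := by
  simp only [kappa, add_mul, mul_add, smul_mul_assoc, mul_smul_comm, one_mul, mul_one]

/-- `kappa θ * W = -sin θ · 1 + cos θ · W` (`W² = -1`), the derivative of `kappa`. [folklore] -/
theorem kappa_mul_W_eq (θ : ℝ) :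
    kappa θ * W = (-Real.sin θ) • (1 : Matrix (Fin 2) (Fin 2) ℝ) + Real.cos θ • W := by
  simp only [kappa, add_mul, smul_mul_assoc, one_mul, W_mul_W, smul_neg, neg_smul]
  abel

/-- The addition formula `kappa θ * kappa θ' = kappa (θ + θ')` (`cos² + sin² = 1`, `W² = -1`). [folklore] -/
theorem kappa_mul_kappa (θ θ' : ℝ) : kappa θ * kappa θ' = kappa (θ + θ') := by
  simp only [kappa, add_mul, mul_add, smul_mul_assoc, mul_smul_comm, one_mul, mul_one, W_mul_W,
    Real.cos_add, Real.sin_add, smul_neg]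
  module

/-- `kappa θ * kappa (-θ) = 1`. [folklore] -/
theorem kappa_mul_kappa_neg (θ : ℝ) : kappa θ * kappa (-θ) = 1 := by
  rw [kappa_mul_kappa, add_neg_cancel, kappa_zero]

section Analysis

open scoped Matrix.Norms.Operator

/-- `kappa` is differentiable with derivative `kappa θ * W` (in the Banach algebra
`Matrix (Fin 2) (Fin 2) ℝ` with the `L^∞` operator norm). [folklore] -/
theorem hasDerivAt_kappa (θ : ℝ) : HasDerivAt kappa (kappa θ * W) θ := by
  rw [kappa_mul_W_eq]
  have h1 := (Real.hasDerivAt_cos θ).smul_const (1 : Matrix (Fin 2) (Fin 2) ℝ)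
  have h2 := (Real.hasDerivAt_sin θ).smul_const W
  exact h1.add h2

/-- `exp (θ W) = kappa θ`, stated inside the operator-norm scope (see `exp_smul_W`). [folklore] -/
theorem exp_smul_W' (θ : ℝ) : exp (θ • W) = kappa θ := by
  set F : ℝ → Matrix (Fin 2) (Fin 2) ℝ := fun t ↦ exp (t • W) * kappa (-t) with hF
  have hderiv : ∀ t : ℝ, HasDerivAt F 0 t := by
    intro t
    have h1 : HasDerivAt (fun u : ℝ ↦ exp (u • W)) (exp (t • W) * W) t := hasDerivAt_exp_smul_const W t
    have h2 : HasDerivAt (fun u : ℝ ↦ kappa (-u)) (-(kappa (-t) * W)) t := by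
      have h := (hasDerivAt_kappa (-t)).scomp t (hasDerivAt_neg t)
      have he : (kappa ∘ Neg.neg) = fun u : ℝ ↦ kappa (-u) := rfl
      rw [he, neg_one_smul] at h
      exact h
    have h3 := h1.mul h2
    refine h3.congr_deriv ?_
    rw [mul_neg, ← mul_assoc, mul_assoc (exp (t • W)) W, ← kappa_mul_W, ← mul_assoc, add_neg_cancel]
  have hconst : F θ = F 0 := by
    have hdiff : Differentiable ℝ F := fun t ↦ (hderiv t).differentiableAt
    exact is_const_of_deriv_eq_zero hdiff (fun t ↦ (hderiv t).deriv) θ 0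
  have hF0 : F 0 = 1 := by simp [hF]
  have key : exp (θ • W) * kappa (-θ) = 1 := by rw [← hF0, ← hconst]
  calc exp (θ • W) = exp (θ • W) * (kappa (-θ) * kappa θ) := by
        rw [kappa_mul_kappa, neg_add_cancel, kappa_zero, mul_one]
    _ = kappa θ := by rw [← mul_assoc, key, one_mul]

end Analysis

/-- **`exp (θ W) = cos θ · 1 + sin θ · W = (cos θ, sin θ; -sin θ, cos θ)`**: the one-parameter
group generated by `W = (0 1; -1 0)` is the rotation group `SO(2)` (Bump 1997, (2.18)–(2.19):
`κ_θ = exp(θ W)`).  Proof: `F(θ) = exp(θW) kappa(-θ)` has derivative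
`exp(θW)(W kappa(-θ) - kappa(-θ)W) = 0`, so `F ≡ F(0) = 1`, and `kappa(θ) kappa(-θ) = 1`.
[cite: Bump1997, (2.18)–(2.19)] -/
theorem exp_smul_W (θ : ℝ) : exp (θ • W) = kappa θ :=
  exp_smul_W' θ

/-- `exp (θ W)` in coordinates. [cite: Bump1997, (2.19)] -/
theorem exp_smul_W_eq (θ : ℝ) :
    exp (θ • W) = !![Real.cos θ, Real.sin θ; -Real.sin θ, Real.cos θ] := by
  rw [exp_smul_W, kappa_eq]

/-- **Periodicity: `exp (2π W) = 1`.** [folklore] -/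
theorem exp_two_pi_smul_W : exp ((2 * Real.pi) • W) = 1 := by
  rw [exp_smul_W, kappa, Real.cos_two_pi, Real.sin_two_pi, one_smul, zero_smul, add_zero]

/-- **Half turn: `exp (π W) = -1`.** [folklore] -/
theorem exp_pi_smul_W : exp (Real.pi • W) = -1 := by
  rw [exp_smul_W, kappa, Real.cos_pi, Real.sin_pi, zero_smul, add_zero, neg_smul, one_smul]

/-! ### `O(2)`: orthogonal `2 × 2` matrices are rotations or reflected rotations -/

/-- The reflected rotation `kappa θ · diag(1, -1)` in coordinates. [folklore] -/
theorem kappa_mul_X₁ (θ : ℝ) :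
    kappa θ * X₁ = !![Real.cos θ, -Real.sin θ; -Real.sin θ, -Real.cos θ] := by
  rw [kappa_eq]
  ext i j
  fin_cases i <;> fin_cases j <;> simp [X₁, Matrix.mul_apply, Fin.sum_univ_two]

/-- **A real orthogonal `2 × 2` matrix is `kappa θ` or `kappa θ · diag(1, -1)`** for some `θ`:
`gᵀ g = 1` makes the first column `(a, c)` a unit vector, `a = cos θ`, `c = -sin θ` for
`θ = arg (a - ic)`, and the second column, orthogonal to it and of norm one, is
`± (sin θ, cos θ)`. (`O(2) = SO(2) ⊔ SO(2) ε`.) [folklore] -/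
theorem exists_kappa_of_orthogonal {g : Matrix (Fin 2) (Fin 2) ℝ} (hg : gᵀ * g = 1) :
    ∃ θ : ℝ, g = kappa θ ∨ g = kappa θ * X₁ := by
  -- read off the relations
  have h00 := congrFun (congrFun hg 0) 0
  have h01 := congrFun (congrFun hg 0) 1
  have h11 := congrFun (congrFun hg 1) 1
  simp only [Matrix.mul_apply, Matrix.transpose_apply, Fin.sum_univ_two, Matrix.one_apply_eq,
    Matrix.one_apply_ne (show (0 : Fin 2) ≠ 1 by decide)] at h00 h01 h11
  set a := g 0 0; set b := g 0 1; set c := g 1 0; set d := g 1 1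
  -- the angle of the unit vector `(a, -c)`
  set z : ℂ := ⟨a, -c⟩ with hz
  have hz1 : ‖z‖ = 1 := by
    have h2 : ‖z‖ ^ 2 = 1 := by
      rw [Complex.sq_norm, Complex.normSq_apply]
      simp only [hz]
      nlinarith [h00]
    have hn : 0 ≤ ‖z‖ := norm_nonneg z
    nlinarith [h2, hn]
  have hz0 : z ≠ 0 := by
    intro h; rw [h, norm_zero] at hz1; exact one_ne_zero hz1.symm
  set θ := Complex.arg z with hθ
  have hcos : Real.cos θ = a := by
    have := Complex.cos_arg hz0
    rw [hz1, div_one] at this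
    simpa [hz] using this
  have hsin : Real.sin θ = -c := by
    have := Complex.sin_arg z
    rw [hz1, div_one] at this
    simpa [hz] using this
  refine ⟨θ, ?_⟩
  have hc : c = -Real.sin θ := by rw [hsin, neg_neg]
  have ha : a = Real.cos θ := hcos.symm
  have hcs : Real.cos θ ^ 2 + Real.sin θ ^ 2 = 1 := by rw [Real.cos_sq_add_sin_sq]
  -- solve `a b + c d = 0`, `b² + d² = 1`: `(b, d) = ± (sin θ, cos θ)`
  have key : (b = Real.sin θ ∧ d = Real.cos θ) ∨ (b = -Real.sin θ ∧ d = -Real.cos θ) := by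
    rw [ha, hc] at h01
    set s := b * Real.sin θ + d * Real.cos θ with hs
    have hu0 : b * Real.cos θ - d * Real.sin θ = 0 := by linarith [h01]
    have hb : b = s * Real.sin θ := by
      rw [hs]; linear_combination (-b) * hcs + Real.cos θ * hu0
    have hd : d = s * Real.cos θ := by
      rw [hs]; linear_combination (-d) * hcs - Real.sin θ * hu0
    have hs1 : s * s = 1 := by
      have h2 : b * b + d * d = 1 := h11
      rw [hb, hd] at h2
      linear_combination h2 - s * s * hcs
    rcases mul_self_eq_one_iff.mp hs1 with h1 | h1
    · left; rw [hb, hd, h1, one_mul, one_mul]; exact ⟨rfl, rfl⟩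
    · right; rw [hb, hd, h1, neg_one_mul, neg_one_mul]; exact ⟨rfl, rfl⟩
  rcases key with ⟨hb, hd⟩ | ⟨hb, hd⟩
  · left
    rw [kappa_eq]
    ext i j; fin_cases i <;> fin_cases j
    · exact ha
    · exact hb
    · exact hc
    · exact hd
  · right
    rw [kappa_mul_X₁]
    ext i j; fin_cases i <;> fin_cases j
    · exact ha
    · exact hb
    · exact hc
    · exact hd

end GL2Real

end Literature.NumberTheory.Automorphic

end
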